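import Summits.QuantumFields.YangMills.Theorems.PoincareLipschitzWenteOneCentreAverages
import HarnessLib

/-!
# Crux `BlockLipschitzL` (stmt-QuantumFields-23533) ∕ `HistoryTailL` (stmt-QuantumFields-19936), LINE 25, stub S1″ — ROAD (W)
# «the H-system gap at 3π», brick W-ONE «WENTE ONE-CENTRE LEMMA», file 6: THE ONE-CENTRE LEMMA (row (ONE′) of the W-TWO door)

Cell `ym3-torus` (YM ladder rung R3 = continuum SU(2) Yang–Mills on T³ — a RUNG, NOT Clay: not d = 4, not infinite volume,
not a mass gap); TWIN-WIDTH helper seat `ym-ust-19936-w7` g15; `--supports stmt-QuantumFields-19936`; THEOREMS ONLY (0 `def`,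
0 `sorry`, default heartbeats); imports file 5 (the precise representative) and through it files 1–4 of W-ONE, px6 g10's
✓`PoincareLipschitzCircleWirtinger` and px19 g8's ✓`PoincareLipschitzWeakJacobianIdentity`.

THE ONE-CENTRE LEMMA (ROAD (W) memo `ROAD-W-WENTE-3PI-w3g16.md` §2 (W-ONE) with consequences (a)(b)(c), in the letters of px22 g8's
W-TWO door ✓p734262 `PoincareLipschitzWenteTwoPoint`): for ONE component `u` of a finite-energy weak solution of the H-system —
`u a b : E² → ℝ` with weak gradients `Gu Ga Gb` on the plane, `a b ∈ L²_loc`, `∇a ∇b ∈ L²(E²)`, `−Δu = 2 det(∇a, ∇b)` weakly —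
there is a CONTINUOUS representative `ū = u` a.e. such that, with the smooth annular averages `𝒜_R v x = (πR²)⁻¹∫ Ψ(‖y − x‖²∕R²) v`,
`𝒜_R ū x₀ → L` as `R → ∞` and **`|ū x₀ − L| ≤ π⁻¹ ‖∇a‖₂ ‖∇b‖₂`** for every centre `x₀` — Wente's inequality with Topping's sharp
constant `1∕2π` per unit Jacobian (here `Δu = 2·det`), in one-centre form.  px22's door turns it (with W-INV's inversion
invariance) into the TWO-POINT form `|ū x₀ − ū x₁| ≤ π⁻¹‖∇a‖₂‖∇b‖₂`, i.e. (W-OSC) `‖u − c‖_∞ ≤ (1∕2π)‖∇a‖₂‖∇b‖₂`.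

WHAT THIS FILE PROVES:
* ★★ `continuous_pointValue` — the precise representative of file 5 is continuous;
* ★★ `exists_limit_atTop` — `𝒜_R u x₀` converges as `R → ∞` and `|𝒜_r u x₀ − L| ≤ π⁻¹‖∇a‖₂‖∇b‖₂` for every `r > 0` (energy tails);
* ★★★ `wente_oneCentre` — THE EXPORT (ONE′): `∃ Ψ` (continuous, supported in `[1∕4, 1]`, `∫ Ψ(‖z‖²) = π`) such that for all data
  `∃ ū`, `Continuous ū ∧ ū =ᵐ u ∧ (∀ x₀ r, |ū x₀ − 𝒜_r u x₀| ≤ π⁻¹√(∫_{B_r}Σ(Ga e_k)²)√(∫_{B_r}Σ(Gb e_k)²)) ∧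
  ∀ x₀, ∃ L, 𝒜_R ū x₀ → L ∧ |ū x₀ − L| ≤ π⁻¹ √(∫Σ(Ga e_k)²) √(∫Σ(Gb e_k)²)` — px22's row `hONE` token for token.
HONEST SCOPE.  A theorem about ONE component under hypothesis rows (the H-system's (i)(i′)(ii)(iii) per component); nothing of (W-OSC)
as a whole, (F′), (GAP), (TM), S1″, K1, `MeanDeviationL`, `BlockLipschitzL`, `HistoryTailL` is proved here.  YM₃ on T³ is rung R3, not
Clay; YM gap NOT proved; no summit statement is proved here.

References: H. Wente, J. Math. Anal. Appl. 26 (1969) 318–344; H. Brezis, J.-M. Coron [BrezisCoron1985] (Lemma A.1); F. Hélein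
[Helein2002] (§3.1); P. Topping, Comment. Math. Helv. 72 (1997) [Topping1997] (the optimal constant `1∕2π`).
-/

set_option autoImplicit false

noncomputable section

open MeasureTheory Set Function Filter Topology Metric TopologicalSpace
open scoped ContDiff BigOperators RealInnerProductSpace

namespace Summit.QuantumFields.YangMills.Theorems.PoincareLipschitzWenteOneCentre

open Literature.Analysis.FunctionSpaces (HasWeakFDerivOn)
open Summit.QuantumFields.YangMills.Theorems.PoincareLipschitzWenteOneCentreIdentity (annularKernel_props)
open Summit.QuantumFields.YangMills.Theorems.PoincareLipschitzWenteOneCentreBound (opNorm_sq_eq_sum_sq)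
open Summit.QuantumFields.YangMills.Theorems.PoincareLipschitzWenteOneCentreKernel
  (integral_annularKernel_norm_sq continuousAt_annularAverage)
open Summit.QuantumFields.YangMills.Theorems.PoincareLipschitzWenteOneCentreAverages
  (setIntegral_normSq_eq exists_ball_setIntegral_lt exists_tail_setIntegral_lt abs_annularAverage_sub_le_of_subset exists_pointValue)

section Data

variable {u a b : EuclideanSpace ℝ (Fin 2) → ℝ} {Gu Ga Gb : EuclideanSpace ℝ (Fin 2) → EuclideanSpace ℝ (Fin 2) →L[ℝ] ℝ}

/-! ## §1 Continuity of the precise representative -/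

/-- ★★ **The precise representative is continuous**: the small-ball bound `|ū x − 𝒜_r u x| ≤ π⁻¹√(∫_{B_r(x)}‖Ga‖²)√(∫_{B_r(x)}‖Gb‖²)`,
absolute continuity of the energy integrals and continuity of `x ↦ 𝒜_r u x`. [cite: Helein2002, §3.1; Topping1997, Theorem 1] -/
theorem continuous_pointValue (hu : HasWeakFDerivOn (⟨univ, isOpen_univ⟩ : Opens (EuclideanSpace ℝ (Fin 2))) volume u Gu)
    (hGa : Integrable (fun y => ‖Ga y‖ ^ 2) volume) (hGb : Integrable (fun y => ‖Gb y‖ ^ 2) volume)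
    {ū : EuclideanSpace ℝ (Fin 2) → ℝ}
    (hball : ∀ x (r : ℝ), 0 < r → |ū x - (Real.pi * r ^ 2)⁻¹ *
        ∫ y, (4/3 : ℝ) * deriv Real.smoothTransition ((4 * (‖y - x‖ ^ 2 / r ^ 2) - 1) / 3) * u y| ≤
        (Real.pi)⁻¹ * Real.sqrt (∫ y in ball x r, ‖Ga y‖ ^ 2) * Real.sqrt (∫ y in ball x r, ‖Gb y‖ ^ 2)) :
    Continuous ū := by
  have hul : LocallyIntegrable u volume := by
    have := hu.locallyIntegrableOn; simpa [locallyIntegrableOn_univ] using this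
  rw [Metric.continuous_iff]
  intro x ε hε
  have hε3 : 0 < ε / 3 := by positivity
  -- a radius with small energies around `x`
  have hπε : 0 < Real.pi * (ε / 3) := mul_pos Real.pi_pos hε3
  obtain ⟨ra, hra, hA⟩ := exists_ball_setIntegral_lt hGa x hπε
  obtain ⟨rb, hrb, hB⟩ := exists_ball_setIntegral_lt hGb x hπε
  set ρ := min ra rb with hρ
  have hρ0 : 0 < ρ := lt_min hra hrb
  have hE : ∀ {S : Set (EuclideanSpace ℝ (Fin 2))}, S ⊆ ball x ρ →
      (Real.pi)⁻¹ * Real.sqrt (∫ y in S, ‖Ga y‖ ^ 2) * Real.sqrt (∫ y in S, ‖Gb y‖ ^ 2) < ε / 3 := by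
    intro S hS
    have hA' : ∫ y in S, ‖Ga y‖ ^ 2 < Real.pi * (ε / 3) :=
      (setIntegral_mono_set hGa.integrableOn (Filter.Eventually.of_forall fun y => sq_nonneg _)
        (Filter.Eventually.of_forall (hS.trans (ball_subset_ball (min_le_left _ _))))).trans_lt hA
    have hB' : ∫ y in S, ‖Gb y‖ ^ 2 < Real.pi * (ε / 3) :=
      (setIntegral_mono_set hGb.integrableOn (Filter.Eventually.of_forall fun y => sq_nonneg _)
        (Filter.Eventually.of_forall (hS.trans (ball_subset_ball (min_le_right _ _))))).trans_lt hB
    have h1 := Real.sqrt_lt_sqrt (integral_nonneg fun y => sq_nonneg _) hA'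
    have h2 := Real.sqrt_lt_sqrt (integral_nonneg fun y => sq_nonneg _) hB'
    have h3 := mul_lt_mul'' h1 h2 (Real.sqrt_nonneg _) (Real.sqrt_nonneg _)
    rw [Real.mul_self_sqrt hπε.le] at h3
    rw [mul_assoc]
    calc (Real.pi)⁻¹ * (Real.sqrt (∫ y in S, ‖Ga y‖ ^ 2) * Real.sqrt (∫ y in S, ‖Gb y‖ ^ 2))
        < (Real.pi)⁻¹ * (Real.pi * (ε / 3)) := mul_lt_mul_of_pos_left h3 (inv_pos.2 Real.pi_pos)
      _ = ε / 3 := by field_simp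
  -- continuity of the annular average at radius `r := ρ/2`
  set r := ρ / 2 with hr
  have hr0 : 0 < r := by positivity
  have hcont : ContinuousAt (fun x' : EuclideanSpace ℝ (Fin 2) => (Real.pi * r ^ 2)⁻¹ *
      ∫ y, (4/3 : ℝ) * deriv Real.smoothTransition ((4 * (‖y - x'‖ ^ 2 / r ^ 2) - 1) / 3) * u y) x :=
    continuousAt_const.mul (continuousAt_annularAverage hul hr0 x)
  obtain ⟨δ₁, hδ₁, hδ⟩ := Metric.continuousAt_iff.1 hcont (ε / 3) hε3
  refine ⟨min r δ₁, lt_min hr0 hδ₁, fun x' hx' => ?_⟩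
  have hx'r : dist x' x < r := hx'.trans_le (min_le_left _ _)
  have hx'δ : dist x' x < δ₁ := hx'.trans_le (min_le_right _ _)
  -- the three pieces
  have hsub : ball x' r ⊆ ball x ρ := by
    intro y hy
    rw [mem_ball] at hy ⊢
    have := dist_triangle y x' x
    have h2 : r + r = ρ := by rw [hr]; ring
    linarith
  have h1 : |ū x' - (Real.pi * r ^ 2)⁻¹ *
      ∫ y, (4/3 : ℝ) * deriv Real.smoothTransition ((4 * (‖y - x'‖ ^ 2 / r ^ 2) - 1) / 3) * u y| < ε / 3 :=
    (hball x' r hr0).trans_lt (hE hsub)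
  have h2 : |ū x - (Real.pi * r ^ 2)⁻¹ *
      ∫ y, (4/3 : ℝ) * deriv Real.smoothTransition ((4 * (‖y - x‖ ^ 2 / r ^ 2) - 1) / 3) * u y| < ε / 3 :=
    (hball x r hr0).trans_lt (hE (ball_subset_ball (by rw [hr]; linarith)))
  have h3 := hδ hx'δ
  have h1' : dist (ū x') ((Real.pi * r ^ 2)⁻¹ *
      ∫ y, (4/3 : ℝ) * deriv Real.smoothTransition ((4 * (‖y - x'‖ ^ 2 / r ^ 2) - 1) / 3) * u y) < ε / 3 := by
    rwa [Real.dist_eq]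
  have h2' : dist ((Real.pi * r ^ 2)⁻¹ *
      ∫ y, (4/3 : ℝ) * deriv Real.smoothTransition ((4 * (‖y - x‖ ^ 2 / r ^ 2) - 1) / 3) * u y) (ū x) < ε / 3 := by
    rwa [Real.dist_eq, abs_sub_comm]
  calc dist (ū x') (ū x) ≤ dist (ū x') ((Real.pi * r ^ 2)⁻¹ *
          ∫ y, (4/3 : ℝ) * deriv Real.smoothTransition ((4 * (‖y - x'‖ ^ 2 / r ^ 2) - 1) / 3) * u y) +
        dist ((Real.pi * r ^ 2)⁻¹ * ∫ y, (4/3 : ℝ) * deriv Real.smoothTransition ((4 * (‖y - x'‖ ^ 2 / r ^ 2) - 1) / 3) * u y)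
          ((Real.pi * r ^ 2)⁻¹ * ∫ y, (4/3 : ℝ) * deriv Real.smoothTransition ((4 * (‖y - x‖ ^ 2 / r ^ 2) - 1) / 3) * u y) +
        dist ((Real.pi * r ^ 2)⁻¹ * ∫ y, (4/3 : ℝ) * deriv Real.smoothTransition ((4 * (‖y - x‖ ^ 2 / r ^ 2) - 1) / 3) * u y)
          (ū x) := dist_triangle4 _ _ _ _
    _ < ε / 3 + ε / 3 + ε / 3 := by gcongr
    _ = ε := by ring

end Data

section Data2

variable {u a b : EuclideanSpace ℝ (Fin 2) → ℝ} {Gu Ga Gb : EuclideanSpace ℝ (Fin 2) → EuclideanSpace ℝ (Fin 2) →L[ℝ] ℝ}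

/-! ## §2 The limit at infinity -/

/-- ★★ **The annular averages converge at infinity**, and every finite-radius average is within `π⁻¹‖∇a‖₂‖∇b‖₂` of the limit.
[cite: Helein2002, §3.1; Topping1997, Theorem 1] -/
theorem exists_limit_atTop
    (hu : HasWeakFDerivOn (⟨univ, isOpen_univ⟩ : Opens (EuclideanSpace ℝ (Fin 2))) volume u Gu)
    (ha : HasWeakFDerivOn (⟨univ, isOpen_univ⟩ : Opens (EuclideanSpace ℝ (Fin 2))) volume a Ga)
    (hb : HasWeakFDerivOn (⟨univ, isOpen_univ⟩ : Opens (EuclideanSpace ℝ (Fin 2))) volume b Gb)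
    (ha2 : LocallyIntegrable (fun y => a y ^ 2) volume) (hb2 : LocallyIntegrable (fun y => b y ^ 2) volume)
    (hGa : Integrable (fun y => ‖Ga y‖ ^ 2) volume) (hGb : Integrable (fun y => ‖Gb y‖ ^ 2) volume)
    (hEq : ∀ η : EuclideanSpace ℝ (Fin 2) → ℝ, ContDiff ℝ ∞ η → HasCompactSupport η →
      -(∫ y, ∑ k : Fin 2, fderiv ℝ η y (EuclideanSpace.single k (1:ℝ)) * Gu y (EuclideanSpace.single k (1:ℝ))) =
        2 * ∫ y, η y * (Ga y (EuclideanSpace.single 0 (1:ℝ)) * Gb y (EuclideanSpace.single 1 (1:ℝ)) -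
          Ga y (EuclideanSpace.single 1 (1:ℝ)) * Gb y (EuclideanSpace.single 0 (1:ℝ))))
    (x : EuclideanSpace ℝ (Fin 2)) :
    ∃ L : ℝ, Tendsto (fun R : ℝ => (Real.pi * R ^ 2)⁻¹ *
        ∫ y, (4/3 : ℝ) * deriv Real.smoothTransition ((4 * (‖y - x‖ ^ 2 / R ^ 2) - 1) / 3) * u y) atTop (𝓝 L) ∧
      ∀ r : ℝ, 0 < r → |(Real.pi * r ^ 2)⁻¹ *
        (∫ y, (4/3 : ℝ) * deriv Real.smoothTransition ((4 * (‖y - x‖ ^ 2 / r ^ 2) - 1) / 3) * u y) - L| ≤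
        (Real.pi)⁻¹ * Real.sqrt (∫ y, ‖Ga y‖ ^ 2) * Real.sqrt (∫ y, ‖Gb y‖ ^ 2) := by
  have hGa2 : LocallyIntegrable (fun y => ‖Ga y‖ ^ 2) volume := hGa.locallyIntegrable
  have hGb2 : LocallyIntegrable (fun y => ‖Gb y‖ ^ 2) volume := hGb.locallyIntegrable
  -- two radii against any measurable superset
  have hS : ∀ (r₀ r₁ : ℝ) (S : Set (EuclideanSpace ℝ (Fin 2))), 0 < r₀ → r₀ ≤ r₁ →
      {y | r₀ / 2 < ‖y - x‖ ∧ ‖y - x‖ < r₁} ⊆ S →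
      |(Real.pi * r₀ ^ 2)⁻¹ * (∫ y, (4/3 : ℝ) * deriv Real.smoothTransition ((4 * (‖y - x‖ ^ 2 / r₀ ^ 2) - 1) / 3) * u y) -
        (Real.pi * r₁ ^ 2)⁻¹ * (∫ y, (4/3 : ℝ) * deriv Real.smoothTransition ((4 * (‖y - x‖ ^ 2 / r₁ ^ 2) - 1) / 3) * u y)| ≤
        (Real.pi)⁻¹ * Real.sqrt (∫ y in S, ‖Ga y‖ ^ 2) * Real.sqrt (∫ y in S, ‖Gb y‖ ^ 2) :=
    fun r₀ r₁ S hr₀ hle hsub => abs_annularAverage_sub_le_of_subset hu ha hb ha2 hb2 hGa2 hGb2 hEq x hr₀ hle hsub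
      hGa.integrableOn hGb.integrableOn
  -- Cauchy at infinity
  have hC : CauchySeq fun R : ℝ => (Real.pi * R ^ 2)⁻¹ *
      ∫ y, (4/3 : ℝ) * deriv Real.smoothTransition ((4 * (‖y - x‖ ^ 2 / R ^ 2) - 1) / 3) * u y := by
    rw [Metric.cauchySeq_iff]
    intro ε hε
    have hπε : 0 < Real.pi * ε := mul_pos Real.pi_pos hε
    obtain ⟨na, hA⟩ := exists_tail_setIntegral_lt hGa x hπε
    obtain ⟨nb, hB⟩ := exists_tail_setIntegral_lt hGb x hπε
    set T : Set (EuclideanSpace ℝ (Fin 2)) := (closedBall x (max na nb : ℕ))ᶜ with hT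
    have hTa : ∫ y in T, ‖Ga y‖ ^ 2 < Real.pi * ε :=
      (setIntegral_mono_set hGa.integrableOn (Filter.Eventually.of_forall fun y => sq_nonneg _)
        (Filter.Eventually.of_forall (compl_subset_compl.2 (closedBall_subset_closedBall
          (by exact_mod_cast le_max_left na nb))))).trans_lt hA
    have hTb : ∫ y in T, ‖Gb y‖ ^ 2 < Real.pi * ε :=
      (setIntegral_mono_set hGb.integrableOn (Filter.Eventually.of_forall fun y => sq_nonneg _)
        (Filter.Eventually.of_forall (compl_subset_compl.2 (closedBall_subset_closedBall
          (by exact_mod_cast le_max_right na nb))))).trans_lt hB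
    have hTε : (Real.pi)⁻¹ * Real.sqrt (∫ y in T, ‖Ga y‖ ^ 2) * Real.sqrt (∫ y in T, ‖Gb y‖ ^ 2) < ε := by
      have h1 := Real.sqrt_lt_sqrt (integral_nonneg fun y => sq_nonneg _) hTa
      have h2 := Real.sqrt_lt_sqrt (integral_nonneg fun y => sq_nonneg _) hTb
      have h3 := mul_lt_mul'' h1 h2 (Real.sqrt_nonneg _) (Real.sqrt_nonneg _)
      rw [Real.mul_self_sqrt hπε.le] at h3
      rw [mul_assoc]
      calc (Real.pi)⁻¹ * (Real.sqrt (∫ y in T, ‖Ga y‖ ^ 2) * Real.sqrt (∫ y in T, ‖Gb y‖ ^ 2))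
          < (Real.pi)⁻¹ * (Real.pi * ε) := mul_lt_mul_of_pos_left h3 (inv_pos.2 Real.pi_pos)
        _ = ε := by field_simp
    refine ⟨2 * ((max na nb : ℕ) : ℝ) + 2, fun m hm n hn => ?_⟩
    have hM0 : (0:ℝ) ≤ ((max na nb : ℕ) : ℝ) := Nat.cast_nonneg _
    have hm0 : 0 < m := by linarith
    have hn0 : 0 < n := by linarith
    have hsub : ∀ {p q : ℝ}, 2 * ((max na nb : ℕ) : ℝ) + 2 ≤ p → {y | p / 2 < ‖y - x‖ ∧ ‖y - x‖ < q} ⊆ T := by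
      intro p q hp y hy hyT
      rw [mem_closedBall, dist_eq_norm] at hyT
      linarith [hy.1]
    rw [Real.dist_eq]
    rcases le_total m n with hmn | hnm
    · exact (hS m n T hm0 hmn (hsub hm)).trans_lt hTε
    · rw [abs_sub_comm]; exact (hS n m T hn0 hnm (hsub hn)).trans_lt hTε
  obtain ⟨L, hL⟩ := cauchySeq_tendsto_of_complete hC
  refine ⟨L, hL, fun r hr => ?_⟩
  have hlim := (hL.const_sub ((Real.pi * r ^ 2)⁻¹ *
      ∫ y, (4/3 : ℝ) * deriv Real.smoothTransition ((4 * (‖y - x‖ ^ 2 / r ^ 2) - 1) / 3) * u y)).abs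
  refine le_of_tendsto hlim ?_
  filter_upwards [Filter.eventually_ge_atTop r] with R hR
  have h := hS r R univ hr hR (subset_univ _)
  rwa [Measure.restrict_univ] at h

end Data2

/-! ## §3 The one-centre lemma — row (ONE′) of the two-point door -/

/-- ★★★ **WENTE'S INEQUALITY, ONE-CENTRE FORM (sharp constant), as row (ONE′) of px22 g8's two-point door.**  There is a kernel `Ψ`
(continuous, vanishing off `(1∕4, 1)`, with `∫_{E²} Ψ(‖z‖²) dz = π`) such that for every component `u` of a finite-energy weak
solution of the planar H-system — `u a b` with weak gradients `Gu Ga Gb` on the plane, `a b ∈ L²_loc`, `∇a ∇b ∈ L²`, and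
`−∫ Σ_k ∂_kη Gu e_k = 2∫ η (Ga e₀ Gb e₁ − Ga e₁ Gb e₀)` for all test functions — there is a CONTINUOUS `ū = u` a.e. with
`|ū x₀ − 𝒜_r u x₀| ≤ π⁻¹ √(∫_{B_r(x₀)} Σ_k (Ga e_k)²) √(∫_{B_r(x₀)} Σ_k (Gb e_k)²)` for all `r > 0`, and for every centre `x₀` a limit
`L` of the smooth annular averages `𝒜_R ū x₀ = (πR²)⁻¹ ∫ Ψ(‖y − x₀‖²∕R²) ū(y) dy` as `R → ∞` with
`|ū x₀ − L| ≤ π⁻¹ · ‖∇a‖_{L²} · ‖∇b‖_{L²}`.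
[cite: Topping1997, Theorem 1 (the optimal constant `1∕2π` in Wente's inequality); Helein2002, §3.1 (Wente's lemma by polar coordinates); BrezisCoron1985, Appendix Lemma A.1] -/
theorem wente_oneCentre :
    ∃ Ψ : ℝ → ℝ, (Continuous Ψ ∧ (∀ t : ℝ, t ≤ 1/4 ∨ 1 ≤ t → Ψ t = 0) ∧
        ∫ z : EuclideanSpace ℝ (Fin 2), Ψ (‖z‖ ^ 2) = Real.pi) ∧
      ∀ (u a b : EuclideanSpace ℝ (Fin 2) → ℝ) (Gu Ga Gb : EuclideanSpace ℝ (Fin 2) → EuclideanSpace ℝ (Fin 2) →L[ℝ] ℝ),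
        HasWeakFDerivOn (⟨univ, isOpen_univ⟩ : Opens (EuclideanSpace ℝ (Fin 2))) volume u Gu →
        HasWeakFDerivOn (⟨univ, isOpen_univ⟩ : Opens (EuclideanSpace ℝ (Fin 2))) volume a Ga →
        HasWeakFDerivOn (⟨univ, isOpen_univ⟩ : Opens (EuclideanSpace ℝ (Fin 2))) volume b Gb →
        LocallyIntegrable (fun y => a y ^ 2) volume → LocallyIntegrable (fun y => b y ^ 2) volume →
        Integrable (fun y => ∑ k : Fin 2, (Ga y (EuclideanSpace.single k (1:ℝ))) ^ 2) volume →
        Integrable (fun y => ∑ k : Fin 2, (Gb y (EuclideanSpace.single k (1:ℝ))) ^ 2) volume →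
        (∀ η : EuclideanSpace ℝ (Fin 2) → ℝ, ContDiff ℝ ∞ η → HasCompactSupport η →
          -(∫ y, ∑ k : Fin 2, fderiv ℝ η y (EuclideanSpace.single k (1:ℝ)) * Gu y (EuclideanSpace.single k (1:ℝ))) =
            2 * ∫ y, η y * (Ga y (EuclideanSpace.single 0 (1:ℝ)) * Gb y (EuclideanSpace.single 1 (1:ℝ)) -
              Ga y (EuclideanSpace.single 1 (1:ℝ)) * Gb y (EuclideanSpace.single 0 (1:ℝ)))) →
        ∃ ū : EuclideanSpace ℝ (Fin 2) → ℝ, Continuous ū ∧ ū =ᵐ[volume] u ∧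
          (∀ (x₀ : EuclideanSpace ℝ (Fin 2)) (r : ℝ), 0 < r →
            |ū x₀ - (Real.pi * r ^ 2)⁻¹ * ∫ y, Ψ (‖y - x₀‖ ^ 2 / r ^ 2) * u y| ≤
              (Real.pi)⁻¹ * Real.sqrt (∫ y in ball x₀ r, ∑ k : Fin 2, (Ga y (EuclideanSpace.single k (1:ℝ))) ^ 2) *
                Real.sqrt (∫ y in ball x₀ r, ∑ k : Fin 2, (Gb y (EuclideanSpace.single k (1:ℝ))) ^ 2)) ∧
          ∀ x₀ : EuclideanSpace ℝ (Fin 2), ∃ L : ℝ,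
            Tendsto (fun R : ℝ => (Real.pi * R ^ 2)⁻¹ * ∫ y, Ψ (‖y - x₀‖ ^ 2 / R ^ 2) * ū y) atTop (𝓝 L) ∧
            |ū x₀ - L| ≤ (Real.pi)⁻¹ * Real.sqrt (∫ y, ∑ k : Fin 2, (Ga y (EuclideanSpace.single k (1:ℝ))) ^ 2) *
              Real.sqrt (∫ y, ∑ k : Fin 2, (Gb y (EuclideanSpace.single k (1:ℝ))) ^ 2) := by
  obtain ⟨hΨc, hΨ0⟩ := annularKernel_props
  refine ⟨fun t => (4/3 : ℝ) * deriv Real.smoothTransition ((4 * t - 1) / 3), ⟨hΨc, hΨ0, ?_⟩, ?_⟩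
  · simpa using integral_annularKernel_norm_sq
  intro u a b Gu Ga Gb hu ha hb ha2 hb2 hGaS hGbS hEq
  -- energies in the `‖·‖²` letters
  have hnorm : ∀ (G : EuclideanSpace ℝ (Fin 2) → EuclideanSpace ℝ (Fin 2) →L[ℝ] ℝ),
      (fun y => ‖G y‖ ^ 2) = fun y => ∑ k : Fin 2, (G y (EuclideanSpace.single k (1:ℝ))) ^ 2 :=
    fun G => funext fun y => opNorm_sq_eq_sum_sq (G y)
  have hGa : Integrable (fun y => ‖Ga y‖ ^ 2) volume := by rw [hnorm Ga]; exact hGaS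
  have hGb : Integrable (fun y => ‖Gb y‖ ^ 2) volume := by rw [hnorm Gb]; exact hGbS
  obtain ⟨ū, hlim0, hball, hae⟩ := exists_pointValue hu ha hb ha2 hb2 hGa hGb hEq
  refine ⟨ū, continuous_pointValue hu hGa hGb hball, hae, fun x₀ r hr => ?_, fun x₀ => ?_⟩
  · have h := hball x₀ r hr
    simp only [hnorm Ga, hnorm Gb] at h
    simpa using h
  · obtain ⟨L, hL, hLr⟩ := exists_limit_atTop hu ha hb ha2 hb2 hGa hGb hEq x₀
    refine ⟨L, ?_, ?_⟩
    · -- `𝒜_R ū = 𝒜_R u`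
      refine hL.congr' (Filter.Eventually.of_forall fun R => ?_)
      simp only
      congr 1
      exact integral_congr_ae (by filter_upwards [hae] with y hy; rw [hy])
    · -- pass to the limit `R → ∞` in `|𝒜_{1/R} u x₀ − L| ≤ K`
      have hK := (hlim0 x₀).sub_const L |>.abs
      have hle := le_of_tendsto hK (by
        filter_upwards [Filter.eventually_gt_atTop (0:ℝ)] with R hR
        exact hLr R⁻¹ (inv_pos.2 hR))
      simp only [hnorm Ga, hnorm Gb] at hle
      simpa using hle

end Summit.QuantumFields.YangMills.Theorems.PoincareLipschitzWenteOneCentre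

end
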